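import Literature.IUT.HodgeTheaters.Cor53iArithUnitsEndOfCor411
import Literature.AlgebraicGeometry.Frobenioids.GaloisEquivariantUnitsEndomorphismRigidity
import HarnessLib

/-!
# [IUTchI] Ex 5.1 (ii)/(iii)/(v) at the WHISKERED arithmetic data (the `⊚`-slot `ℱ^⊚ = ℱ^⊛|_{†𝒟^⊚}`): a natural
# automorphism of the rational-function monoid `𝔹 ∘ S` along a GALOIS-RICH whiskering `S` that relabels finite primes on
# principal divisors is the IDENTITY (gluing to ONE `Gal(F̄/K₀)`-equivariant endomorphism of `F̄^×`)

S. Mochizuki, *Inter-universal Teichmüller theory I*, kurims manuscript (May 2020), §5 Example 5.1 (ii)/(iii) pp. 125–126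
(`†ℱ^⊚ := †ℱ^⊛|_{†𝒟^⊚}`, the restriction along `†𝒟^⊚ → †𝒟^⊛`), (v) pp. 127–128 («`ℚ_{>0} ∩ Ẑ^× = {1}`»), consumer locus
Corollary 5.3 (i) «resp. `⊚`» p. 144 ([IUTchI] Ex 5.1 (v) p.128; Cor 5.3 (i) p.144) [claim: Mochizuki2012, status: disputed] (D-0012
claim key; nothing of the series is asserted; no side taken on [IUTchIII] Cor. 3.12).  The mathematics is CLASSICAL (OURS) over the
[FrdI] Ex 6.3 data `B : Spec L ↦ L^×`, `div` [cite: MochizukiFrdI2008, Ex. 6.3 p.113] and abc-iut-L5-t16's rigidity ★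
`eq_id_of_galEquivariant_of_ordFin_perm` (`GaloisEquivariantUnitsEndomorphismRigidity.lean`).

PROOF-ONLY (cell abc-iut, seat abc-iut-L5-t11 gen 17, row «HBCIRC-PUSH» file (⊚-1), abc-iut-L5-lead gen 10 RULINGS #173 (3) /
#179; 0 def / 0 instance / 0 notation / no Prop fact).  The `⊚`-slot binder `hB⊚` of ★ `Cor53iFcircHkerTransport` lives on the model
Frobenioid of a WHISKERED arithmetic datum `(Φ^⊛ ∘ S, 𝔹 ∘ S, Div ∘ S)`, `S : ℬ(H)⁰ → FinSubextCat F F̄`; AS TYPED (every `S`) it is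
refutable at a constant `S` (abc-iut-L5-t16 «HB⊚-DEGENERATE-CARRIER»); its categorical half holds for every `S` (★
`Cor53.whisker_exists_unitsAut_of_overBase`).  THIS FILE is the number-theoretic half along the whiskerings that DO occur
([IUTchI] Ex 5.1 (i)/(iii): `†𝒟^⊚ → †𝒟^⊛` from the finite étale `C_K → C_{F_mod}` = induction along an OPEN INJECTION of
fundamental groups, whose field image is ALL finite extensions of one number field `K₀` with their inclusions and
`Gal(F̄/K₀)`-conjugations), for an ARBITRARY index category `C`, through three GALOIS-RICHNESS binders displayed INLINE
(`K₀ := (S c₀).L`): (G1) COVER — every element of `F̄` lies in some `(S c).L`; (G2) DIRECTED BY INCLUSIONS — any two objects are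
dominated by a third through arrows that `S` sends to set-theoretic INCLUSIONS; (G3) GALOIS ARROWS — every `σ ∈ Gal(F̄/K₀)` is
realised on a field containing any given element by an arrow of `C`.
* **`whisker_unitsFamily_apply_eq_self_of_galoisRich`** — a family `ᾱ_c : (S c).L^× ⥲ (S c).L^×` natural along `C` whose
  `Div`-law at `c₀` goes through SOME monoid automorphism of `EffArithDivisor(K₀)` is the IDENTITY: glue `ᾱ̄(u) := ᾱ_c(u)`
  (`u ∈ (S c).L`; well defined by (G2) + naturality), a `Gal(F̄/K₀)`-equivariant ((G3)) endomorphism of `F̄^×` relabelling the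
  finite places of `K₀` on `K₀^×` (★ `EffArithDivisor.exists_perm_ordFin_of_divisor_law`); abc-iut-L5-t16's ★
  `eq_id_of_galEquivariant_of_ordFin_perm` over the number field `K₀` gives `ᾱ̄ = 1`.
* **`whisker_unitsFamily_apply_eq_self_of_iso_galoisRich`** — the same for `S` merely ISOMORPHIC to a Galois-rich `S′` (the
  record's `𝓕.baseMor ⋙ 𝓕.identify ⋙ galoisSubextOfFinite` is only isomorphic to the induced whiskering, and `fixFld` uses chosen
  base points): conjugate by `(φ_c)^*`; the `Div`-law moves by NATURALITY of `Div` (`pullGp_divB_pull`) alone.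
HONEST TAGS: classical lemmas about OUR model; the instance «`toBase0` = induction `CosetCat.push ι` ⇒ Galois-rich» is NOT in this
file; typed ≠ inhabited ≠ proved; nothing here asserts abc proved or refuted.
-/

noncomputable section

set_option backward.isDefEq.respectTransparency false

namespace Literature.IUT.HodgeTheaters

open CategoryTheory Opposite NumberField Literature.AlgebraicGeometry.Frobenioids
open Literature.AlgebraicGeometry.Frobenioids.QuasiTemperoid

namespace GlobalDivisorData

universe v u

variable (F : Type) [Field F] [NumberField F] {C : Type u} [Category.{v} C]

/-! ### § 1. Gluing along a Galois-rich whiskering, and rigidity -/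

/-- **Rigidity of the whiskered rational-function monoid `𝔹 ∘ S` along a GALOIS-RICH `S : C → FinSubextCat F F̄`** (binders
(G1) `hcov`, (G2) `hdir`, (G3) `hgal`, `K₀ := (S c₀).L`): every family of automorphisms `ᾱ_c` of `(S c).L^×` natural along `C` whose
`Div`-law at `c₀` goes through a monoid automorphism `ε` of `EffArithDivisor(K₀)` is the identity, `ᾱ_c w = w` (glue to ONE
`Gal(F̄/K₀)`-equivariant `ᾱ̄ : F̄^× → F̄^×` relabelling finite places on `K₀^×`; abc-iut-L5-t16's ★ `eq_id_of_galEquivariant_of_ordFin_perm`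
over `K₀`). ([IUTchI] Ex 5.1 (v) p.128) [cite: MochizukiFrdI2008, Ex. 6.3 p.113] [claim: Mochizuki2012, status: disputed] -/
theorem whisker_unitsFamily_apply_eq_self_of_galoisRich (S : C ⥤ FinSubextCat F (Fbar F)) (c₀ : C)
    (hcov : ∀ u : Fbar F, ∃ c : C, u ∈ (S.obj c).L)
    (hdir : ∀ c₁ c₂ : C, ∃ (c₃ : C) (g₁ : c₃ ⟶ c₁) (g₂ : c₃ ⟶ c₂),
      (∀ y : (S.obj c₁).L, (((S.map g₁).toAlgHom y : (S.obj c₃).L) : Fbar F) = y) ∧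
      (∀ y : (S.obj c₂).L, (((S.map g₂).toAlgHom y : (S.obj c₃).L) : Fbar F) = y))
    (hgal : ∀ (σ : Fbar F ≃ₐ[(S.obj c₀).L] Fbar F) (u : Fbar F), ∃ (c c' : C) (g : c' ⟶ c),
      u ∈ (S.obj c).L ∧ ∀ y : (S.obj c).L, (((S.map g).toAlgHom y : (S.obj c').L) : Fbar F) = σ y)
    (ᾱ : ∀ c : C, (S.op ⋙ unitsFunctor F (Fbar F)).obj (op c) ≃* (S.op ⋙ unitsFunctor F (Fbar F)).obj (op c))
    (hnat : ∀ ⦃c' c : C⦄ (g : c' ⟶ c) (w : (S.op ⋙ unitsFunctor F (Fbar F)).obj (op c)),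
      ᾱ c' (pull (S.op ⋙ unitsFunctor F (Fbar F)) g w) = pull (S.op ⋙ unitsFunctor F (Fbar F)) g (ᾱ c w))
    (ε : (S.op ⋙ arithDivisorFunctor F (Fbar F)).obj (op c₀) ≃* (S.op ⋙ arithDivisorFunctor F (Fbar F)).obj (op c₀))
    (hdiv : ∀ w : (S.op ⋙ unitsFunctor F (Fbar F)).obj (op c₀),
      divB (S.op ⋙ arithDivisorFunctor F (Fbar F)) (S.op ⋙ unitsFunctor F (Fbar F))
          (Functor.whiskerLeft S.op (divNatTrans F (Fbar F))) (op c₀) (ᾱ c₀ w) =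
        MonGp.map ε.toMonoidHom (divB (S.op ⋙ arithDivisorFunctor F (Fbar F)) (S.op ⋙ unitsFunctor F (Fbar F))
          (Functor.whiskerLeft S.op (divNatTrans F (Fbar F))) (op c₀) w))
    (c : C) (w : (S.op ⋙ unitsFunctor F (Fbar F)).obj (op c)) : ᾱ c w = w := by
  haveI : IsGalois F (Fbar F) := isGalois_fbar F
  haveI : IsGalois (S.obj c₀).L (Fbar F) := IsGalois.tower_top_of_isGalois F (S.obj c₀).L (Fbar F)
  have hpull : ∀ ⦃c' c : C⦄ (g : c' ⟶ c) (w : (S.op ⋙ unitsFunctor F (Fbar F)).obj (op c)),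
      (((pull (S.op ⋙ unitsFunctor F (Fbar F)) g w).val : (S.obj c').L) : Fbar F) =
        (S.map g).toAlgHom (w.val : (S.obj c).L) := fun _ _ _ _ => rfl
  have hunit : ∀ (c : C) (u : (Fbar F)ˣ), (u : Fbar F) ∈ (S.obj c).L →
      ∃ w : (S.op ⋙ unitsFunctor F (Fbar F)).obj (op c), ((w.val : (S.obj c).L) : Fbar F) = u :=
    fun c u hu => ⟨Units.mk0 (⟨(u : Fbar F), hu⟩ : (S.obj c).L) (fun h => u.ne_zero (congrArg Subtype.val h)), rfl⟩
  -- (G2) + naturality: the value of `ᾱ` on an element of `F̄` does not depend on the object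
  have hwd : ∀ (c₁ c₂ : C) (w₁ : (S.op ⋙ unitsFunctor F (Fbar F)).obj (op c₁))
      (w₂ : (S.op ⋙ unitsFunctor F (Fbar F)).obj (op c₂)),
      ((w₁.val : (S.obj c₁).L) : Fbar F) = ((w₂.val : (S.obj c₂).L) : Fbar F) →
      (((ᾱ c₁ w₁).val : (S.obj c₁).L) : Fbar F) = (((ᾱ c₂ w₂).val : (S.obj c₂).L) : Fbar F) := by
    intro c₁ c₂ w₁ w₂ h
    obtain ⟨c₃, g₁, g₂, hg₁, hg₂⟩ := hdir c₁ c₂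
    have e : pull (S.op ⋙ unitsFunctor F (Fbar F)) g₁ w₁ = pull (S.op ⋙ unitsFunctor F (Fbar F)) g₂ w₂ := by
      apply Units.ext; apply Subtype.ext
      rw [hpull, hpull, hg₁, hg₂, h]
    have key := congrArg (fun z : (S.op ⋙ unitsFunctor F (Fbar F)).obj (op c₃) => ((z.val : (S.obj c₃).L) : Fbar F))
      ((hnat g₁ w₁).symm.trans ((congrArg (ᾱ c₃) e).trans (hnat g₂ w₂)))
    change (((pull (S.op ⋙ unitsFunctor F (Fbar F)) g₁ (ᾱ c₁ w₁)).val : (S.obj c₃).L) : Fbar F) =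
      (((pull (S.op ⋙ unitsFunctor F (Fbar F)) g₂ (ᾱ c₂ w₂)).val : (S.obj c₃).L) : Fbar F) at key
    rwa [hpull, hpull, hg₁, hg₂] at key
  have hcov' : ∀ u : (Fbar F)ˣ, ∃ (c : C) (w : (S.op ⋙ unitsFunctor F (Fbar F)).obj (op c)),
      ((w.val : (S.obj c).L) : Fbar F) = u := fun u => by
    obtain ⟨c, hu⟩ := hcov u
    obtain ⟨w, hw⟩ := hunit c u hu
    exact ⟨c, w, hw⟩
  choose cu wu hwu using hcov'
  let f : (Fbar F)ˣ → (Fbar F)ˣ := fun u =>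
    Units.map (algebraMap (S.obj (cu u)).L (Fbar F) : (S.obj (cu u)).L →* Fbar F) (ᾱ (cu u) (wu u))
  have hf : ∀ (u : (Fbar F)ˣ) (c : C) (w : (S.op ⋙ unitsFunctor F (Fbar F)).obj (op c)),
      ((w.val : (S.obj c).L) : Fbar F) = u →
      (f u : Fbar F) = (((ᾱ c w).val : (S.obj c).L) : Fbar F) := fun u c w hw =>
    hwd _ _ _ _ ((hwu u).trans hw.symm)
  have hfmul : ∀ u v : (Fbar F)ˣ, f (u * v) = f u * f v := by
    intro u v
    obtain ⟨c₃, g₁, g₂, hg₁, hg₂⟩ := hdir (cu u) (cu v)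
    have hw₁ : (((pull (S.op ⋙ unitsFunctor F (Fbar F)) g₁ (wu u)).val : (S.obj c₃).L) : Fbar F) = u := by
      rw [hpull, hg₁, hwu]
    have hw₂ : (((pull (S.op ⋙ unitsFunctor F (Fbar F)) g₂ (wu v)).val : (S.obj c₃).L) : Fbar F) = v := by
      rw [hpull, hg₂, hwu]
    apply Units.ext
    rw [Units.val_mul, hf u c₃ _ hw₁, hf v c₃ _ hw₂,
      hf (u * v) c₃ (pull (S.op ⋙ unitsFunctor F (Fbar F)) g₁ (wu u) * pull (S.op ⋙ unitsFunctor F (Fbar F)) g₂ (wu v))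
        (by rw [Units.val_mul, MulMemClass.coe_mul, hw₁, hw₂, Units.val_mul]),
      map_mul, Units.val_mul, MulMemClass.coe_mul]
  let ᾱbar : (Fbar F)ˣ →* (Fbar F)ˣ := MonoidHom.mk' f hfmul
  -- (G3) + naturality: `Gal(F̄/K₀)`-equivariance
  have hσ : ∀ (σ : Fbar F ≃ₐ[(S.obj c₀).L] Fbar F) (x : (Fbar F)ˣ),
      ᾱbar (Units.map (σ : Fbar F →* Fbar F) x) = Units.map (σ : Fbar F →* Fbar F) (ᾱbar x) := by
    intro σ x
    obtain ⟨c, c', g, hx, hg⟩ := hgal σ x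
    obtain ⟨wx, hwx⟩ := hunit c x hx
    have hw' : (((pull (S.op ⋙ unitsFunctor F (Fbar F)) g wx).val : (S.obj c').L) : Fbar F) =
        ((Units.map (σ : Fbar F →* Fbar F) x : (Fbar F)ˣ) : Fbar F) := by
      rw [hpull, hg, hwx, Units.coe_map, MonoidHom.coe_coe]
    apply Units.ext
    change (f (Units.map (σ : Fbar F →* Fbar F) x) : Fbar F) = σ (f x : Fbar F)
    rw [hf _ c' _ hw', hf x c wx hwx, hnat g wx, hpull, hg]
  -- the `Div`-law at `c₀` relabels the finite places of `K₀` on `K₀^×`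
  obtain ⟨π, hπ⟩ := EffArithDivisor.exists_perm_ordFin_of_divisor_law ε (fun u => ᾱ c₀ u) hdiv
  have hval : ∀ u : ((S.obj c₀).L)ˣ, ∃ u' : ((S.obj c₀).L)ˣ,
      Units.map (algebraMap (S.obj c₀).L (Fbar F) : (S.obj c₀).L →* Fbar F) u' =
          ᾱbar (Units.map (algebraMap (S.obj c₀).L (Fbar F) : (S.obj c₀).L →* Fbar F) u) ∧
        ∀ w : FinitePlace (S.obj c₀).L, ordFin (S.obj c₀).L (π w) u' = ordFin (S.obj c₀).L w u := by
    intro u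
    refine ⟨ᾱ c₀ u, Units.ext ?_, hπ u⟩
    change (((ᾱ c₀ u).val : (S.obj c₀).L) : Fbar F) = (f _ : Fbar F)
    exact (hf _ c₀ u rfl).symm
  have hid := eq_id_of_galEquivariant_of_ordFin_perm ᾱbar hσ π hval
  have h1 := hf (Units.map (algebraMap (S.obj c).L (Fbar F) : (S.obj c).L →* Fbar F) w) c w rfl
  have h2 : f (Units.map (algebraMap (S.obj c).L (Fbar F) : (S.obj c).L →* Fbar F) w) =
      Units.map (algebraMap (S.obj c).L (Fbar F) : (S.obj c).L →* Fbar F) w :=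
    DFunLike.congr_fun hid _
  rw [h2] at h1
  exact Units.ext (Subtype.ext h1.symm)

/-! ### § 2. Iso-invariance: the rigidity for any whiskering ISOMORPHIC to a Galois-rich one -/

/-- **The same for `S` merely ISOMORPHIC to a Galois-rich `S′`** (`φ : S ≅ S′`, (G1)–(G3) for `S′`): conjugate `ᾱ` by the
`(S g)^*`-compatible `(φ_c)^* : (S′ c).L^× ⥲ (S c).L^×` into a natural family on `𝔹 ∘ S′` whose `Div`-law at `c₀` goes through
`(φ_{c₀})^* ∘ ε ∘ (φ_{c₀}⁻¹)^*` by NATURALITY of `Div` (`pullGp_divB_pull`), and apply § 1 — the form the `⊚`-knit consumes (the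
record's whiskering is only isomorphic to the induced one). ([IUTchI] Ex 5.1 (v) p.128) [cite: MochizukiFrdI2008, Ex. 6.3 p.113]
[claim: Mochizuki2012, status: disputed] -/
theorem whisker_unitsFamily_apply_eq_self_of_iso_galoisRich (S S' : C ⥤ FinSubextCat F (Fbar F)) (φ : S ≅ S') (c₀ : C)
    (hcov : ∀ u : Fbar F, ∃ c : C, u ∈ (S'.obj c).L)
    (hdir : ∀ c₁ c₂ : C, ∃ (c₃ : C) (g₁ : c₃ ⟶ c₁) (g₂ : c₃ ⟶ c₂),
      (∀ y : (S'.obj c₁).L, (((S'.map g₁).toAlgHom y : (S'.obj c₃).L) : Fbar F) = y) ∧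
      (∀ y : (S'.obj c₂).L, (((S'.map g₂).toAlgHom y : (S'.obj c₃).L) : Fbar F) = y))
    (hgal : ∀ (σ : Fbar F ≃ₐ[(S'.obj c₀).L] Fbar F) (u : Fbar F), ∃ (c c' : C) (g : c' ⟶ c),
      u ∈ (S'.obj c).L ∧ ∀ y : (S'.obj c).L, (((S'.map g).toAlgHom y : (S'.obj c').L) : Fbar F) = σ y)
    (ᾱ : ∀ c : C, (S.op ⋙ unitsFunctor F (Fbar F)).obj (op c) ≃* (S.op ⋙ unitsFunctor F (Fbar F)).obj (op c))
    (hnat : ∀ ⦃c' c : C⦄ (g : c' ⟶ c) (w : (S.op ⋙ unitsFunctor F (Fbar F)).obj (op c)),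
      ᾱ c' (pull (S.op ⋙ unitsFunctor F (Fbar F)) g w) = pull (S.op ⋙ unitsFunctor F (Fbar F)) g (ᾱ c w))
    (ε : (S.op ⋙ arithDivisorFunctor F (Fbar F)).obj (op c₀) ≃* (S.op ⋙ arithDivisorFunctor F (Fbar F)).obj (op c₀))
    (hdiv : ∀ w : (S.op ⋙ unitsFunctor F (Fbar F)).obj (op c₀),
      divB (S.op ⋙ arithDivisorFunctor F (Fbar F)) (S.op ⋙ unitsFunctor F (Fbar F))
          (Functor.whiskerLeft S.op (divNatTrans F (Fbar F))) (op c₀) (ᾱ c₀ w) =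
        MonGp.map ε.toMonoidHom (divB (S.op ⋙ arithDivisorFunctor F (Fbar F)) (S.op ⋙ unitsFunctor F (Fbar F))
          (Functor.whiskerLeft S.op (divNatTrans F (Fbar F))) (op c₀) w))
    (c : C) (w : (S.op ⋙ unitsFunctor F (Fbar F)).obj (op c)) : ᾱ c w = w := by
  -- `(φ_c)^* : (S′ c).L^× ⥲ (S c).L^×` and its inverse, as (opaque) multiplicative equivalences
  obtain ⟨E, hE, hEs⟩ : ∃ E : ∀ c : C,
      (S'.op ⋙ unitsFunctor F (Fbar F)).obj (op c) ≃* (S.op ⋙ unitsFunctor F (Fbar F)).obj (op c),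
      (∀ (c : C) (w' : (S'.op ⋙ unitsFunctor F (Fbar F)).obj (op c)),
          E c w' = pull (unitsFunctor F (Fbar F)) (φ.hom.app c) w') ∧
        ∀ (c : C) (w : (S.op ⋙ unitsFunctor F (Fbar F)).obj (op c)),
          (E c).symm w = pull (unitsFunctor F (Fbar F)) (φ.inv.app c) w :=
    ⟨fun c => ((unitsFunctor F (Fbar F)).mapIso (φ.app c).op).commMonCatIsoToMulEquiv, fun _ _ => rfl, fun _ _ => rfl⟩
  -- the pull-backs along `S g`, `S′ g` are intertwined by `E` (naturality of `φ`)
  have hsq : ∀ ⦃c' c : C⦄ (g : c' ⟶ c) (w' : (S'.op ⋙ unitsFunctor F (Fbar F)).obj (op c)),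
      pull (S.op ⋙ unitsFunctor F (Fbar F)) g (E c w') = E c' (pull (S'.op ⋙ unitsFunctor F (Fbar F)) g w') := by
    intro c' c g w'
    rw [hE, hE]
    change pull (unitsFunctor F (Fbar F)) (S.map g) (pull (unitsFunctor F (Fbar F)) (φ.hom.app c) w') =
      pull (unitsFunctor F (Fbar F)) (φ.hom.app c') (pull (unitsFunctor F (Fbar F)) (S'.map g) w')
    rw [← pull_comp, ← pull_comp, φ.hom.naturality]
  have hsq' : ∀ ⦃c' c : C⦄ (g : c' ⟶ c) (w : (S.op ⋙ unitsFunctor F (Fbar F)).obj (op c)),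
      pull (S'.op ⋙ unitsFunctor F (Fbar F)) g ((E c).symm w) = (E c').symm (pull (S.op ⋙ unitsFunctor F (Fbar F)) g w) := by
    intro c' c g w
    rw [MulEquiv.eq_symm_apply, ← hsq, MulEquiv.apply_symm_apply]
  -- the conjugated family `ᾱ′_c := (φ_c⁻¹)^* ∘ ᾱ_c ∘ (φ_c)^*` on `𝔹 ∘ S′` is natural …
  have hnat' : ∀ ⦃c' c : C⦄ (g : c' ⟶ c) (w' : (S'.op ⋙ unitsFunctor F (Fbar F)).obj (op c)),
      ((E c').trans ((ᾱ c').trans (E c').symm)) (pull (S'.op ⋙ unitsFunctor F (Fbar F)) g w') =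
        pull (S'.op ⋙ unitsFunctor F (Fbar F)) g (((E c).trans ((ᾱ c).trans (E c).symm)) w') := by
    intro c' c g w'
    rw [MulEquiv.trans_apply, MulEquiv.trans_apply, MulEquiv.trans_apply, MulEquiv.trans_apply, ← hsq, hnat, hsq']
  -- … and its `Div`-law at `c₀` goes through `(φ_{c₀})^* ∘ ε ∘ (φ_{c₀}⁻¹)^*` (naturality of `Div`, `ModelFrobenioid.pullGp_divB_pull`)
  have hcomp : ∀ {M N P : Type} [CommMonoid M] [CommMonoid N] [CommMonoid P] (e₁ : M ≃* N) (e₂ : N ≃* P)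
      (x : Algebra.GrothendieckGroup M),
      MonGp.map (e₁.trans e₂).toMonoidHom x = MonGp.map e₂.toMonoidHom (MonGp.map e₁.toMonoidHom x) := by
    intro M N P _ _ _ e₁ e₂ x
    rw [show (e₁.trans e₂).toMonoidHom = e₂.toMonoidHom.comp e₁.toMonoidHom from MonoidHom.ext fun _ => rfl,
      MonGp.map_comp, MonoidHom.comp_apply]
  have hP : ∀ x, MonGp.map ((arithDivisorFunctor F (Fbar F)).mapIso (φ.app c₀).op).commMonCatIsoToMulEquiv.toMonoidHom x =
      pullGp (arithDivisorFunctor F (Fbar F)) (φ.hom.app c₀) x := fun x =>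
    congrArg (fun h => MonGp.map h x) (MonoidHom.ext fun _ => rfl)
  have hP' : ∀ y,
      MonGp.map ((arithDivisorFunctor F (Fbar F)).mapIso (φ.app c₀).op).commMonCatIsoToMulEquiv.symm.toMonoidHom y =
        pullGp (arithDivisorFunctor F (Fbar F)) (φ.inv.app c₀) y := fun y =>
    congrArg (fun h => MonGp.map h y) (MonoidHom.ext fun _ => rfl)
  have hdiv' : ∀ w' : (S'.op ⋙ unitsFunctor F (Fbar F)).obj (op c₀),
      divB (S'.op ⋙ arithDivisorFunctor F (Fbar F)) (S'.op ⋙ unitsFunctor F (Fbar F))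
          (Functor.whiskerLeft S'.op (divNatTrans F (Fbar F))) (op c₀) (((E c₀).trans ((ᾱ c₀).trans (E c₀).symm)) w') =
        MonGp.map (((arithDivisorFunctor F (Fbar F)).mapIso (φ.app c₀).op).commMonCatIsoToMulEquiv.trans
            (ε.trans ((arithDivisorFunctor F (Fbar F)).mapIso (φ.app c₀).op).commMonCatIsoToMulEquiv.symm)).toMonoidHom
          (divB (S'.op ⋙ arithDivisorFunctor F (Fbar F)) (S'.op ⋙ unitsFunctor F (Fbar F))
            (Functor.whiskerLeft S'.op (divNatTrans F (Fbar F))) (op c₀) w') := by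
    intro w'
    rw [MulEquiv.trans_apply, MulEquiv.trans_apply, hEs, hE, hcomp, hcomp, hP, hP']
    change divB (arithDivisorFunctor F (Fbar F)) (unitsFunctor F (Fbar F)) (divNatTrans F (Fbar F)) (op (S'.obj c₀))
        (pull (unitsFunctor F (Fbar F)) (φ.inv.app c₀) (ᾱ c₀ (pull (unitsFunctor F (Fbar F)) (φ.hom.app c₀) w'))) =
      pullGp (arithDivisorFunctor F (Fbar F)) (φ.inv.app c₀) (MonGp.map ε.toMonoidHom
        (pullGp (arithDivisorFunctor F (Fbar F)) (φ.hom.app c₀)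
          (divB (arithDivisorFunctor F (Fbar F)) (unitsFunctor F (Fbar F)) (divNatTrans F (Fbar F)) (op (S'.obj c₀)) w')))
    rw [← ModelFrobenioid.pullGp_divB_pull]
    congr 1
    refine (hdiv _).trans ?_
    congr 1
    exact (ModelFrobenioid.pullGp_divB_pull (Φ := arithDivisorFunctor F (Fbar F)) (B := unitsFunctor F (Fbar F))
      (DivB := divNatTrans F (Fbar F)) (φ.hom.app c₀) w').symm
  have key := whisker_unitsFamily_apply_eq_self_of_galoisRich F S' c₀ hcov hdir hgal
    (fun c => (E c).trans ((ᾱ c).trans (E c).symm)) hnat' _ hdiv' c ((E c).symm w)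
  rw [MulEquiv.trans_apply, MulEquiv.trans_apply, MulEquiv.apply_symm_apply] at key
  exact (E c).symm.injective key

end GlobalDivisorData

end Literature.IUT.HodgeTheaters

end
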